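import Summits.QuantumFields.YangMills.Theorems.IR.Negative.OnsetSharpFalseOfUnpinnedUnit
import Summits.QuantumFields.YangMills.Theorems.BrascampLiebVacuumSC.Negative.AdmissibleInstance

/-!
# Crux `IR` (stmt-QuantumFields-19354), slot «sharp merge I♯_SC» (sha16 28967a1bf60ad397) — companion of
# `OnsetSharpFalseOfUnpinnedUnit`: the simply-connected input DISCHARGED (disprove-1 g8, Negative lane)

`SimplyConnectedSpace SU(2)` is a THEOREM of the tree (`Theorems.BrascampLiebVacuumSC.Negative.simplyConnectedSpace_su2`,
unit quaternions `S³ ≃ SU(2)`); that module imports the `ConvexGribovBody` route file, so the discharge is isolated here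
(theses-cone hygiene) and the main module stays in the cone of `Theorems.IR.AfPincerUcSharpOnset`.

* `not_onsetSharpUKPcSCFree : ¬ OnsetSharpUKPcSCFree` — **the registered stub `stub_onsetSharpSC` with its hypothesis
  `LowerBounds G r a` deleted is FALSE, unconditionally** (witness: `SU(2)`, fundamental representation, the parasitic
  unit `unpinnedUnit`).  Any proof of `stub_onsetSharpSC` must therefore USE `LowerBounds` — quantitatively, as an upper
  bound on the typical onset mesh in the unit `a`.
* `subscaleFailureSC_of_lowerBounds_unpinnedUnit`, `not_onsetSharpUKPcSC_of_lowerBounds_unpinnedUnit` — the census row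
  made kernel-exact: the parasitic witness fails to kill I♯_SC ITSELF for EXACTLY one reason, the pinning `LowerBounds`
  at its own unit.  That hypothesis is physics-grade FALSE (asymptotic freedom: at spacing `1/(M(β)+1) ≫ 1/ξ(β)` the
  test functions of `LowerBounds` sit at lattice separations `≪ ξ(β)`, where the bare `tr F²` covariance is
  `O(g_eff⁴) → 0`, so `Q2 → 0`), which is why the verdict of record stays (B) NOT REFUTED — these two theorems are
  bookkeeping, not a kill route.

Sorry-free; axioms `propext`, `Classical.choice`, `Quot.sound`.  Nothing here asserts a Theses statement.
-/

set_option autoImplicit false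

noncomputable section

open Filter Topology MeasureTheory
open Literature.MathematicalPhysics.QuantumFieldTheory Literature.MathematicalPhysics.QuantumLattice
open Summit.QuantumFields.YangMills.Cruxes.OSLegsFromFemtoAndGap.DlrCollarTransfer (LowerBounds)
open Summit.QuantumFields.YangMills.Cruxes.IR.FixedMesh (fundRepSU2)
open Summit.QuantumFields.YangMills.Theorems.BrascampLiebVacuumSC.Negative (simplyConnectedSpace_su2)

namespace Summit.QuantumFields.YangMills.Cruxes.IR.AfPincerUc.SharpOnset

open Summit.QuantumFields.YangMills.Cruxes.IR.AfPincerUc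

/-- **`¬ OnsetSharpUKPcSCFree` (PROVED, unconditional)**: I♯_SC minus `LowerBounds` is false. -/
theorem not_onsetSharpUKPcSCFree : ¬ OnsetSharpUKPcSCFree :=
  not_onsetSharpUKPcSCFree_of_sc simplyConnectedSpace_su2

/-- **Bookkeeping (PROVED)**: the parasitic witness `(SU(2), fundamental, unpinnedUnit)` inhabits the exact kill-world
`SubscaleFailureSC` AS SOON AS it is pinned, i.e. modulo `LowerBounds SU(2) fund unpinnedUnit` — a hypothesis that is
physics-grade FALSE (asymptotic freedom), recorded only to make the census row exact. -/
theorem subscaleFailureSC_of_lowerBounds_unpinnedUnit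
    (h : letI : MeasurableSpace (Matrix.specialUnitaryGroup (Fin 2) ℂ) := borel _
      haveI : BorelSpace (Matrix.specialUnitaryGroup (Fin 2) ℂ) := ⟨rfl⟩
      LowerBounds (Matrix.specialUnitaryGroup (Fin 2) ℂ) fundRepSU2 unpinnedUnit) :
    SubscaleFailureSC := by
  letI : MeasurableSpace (Matrix.specialUnitaryGroup (Fin 2) ℂ) := borel _
  haveI : BorelSpace (Matrix.specialUnitaryGroup (Fin 2) ℂ) := ⟨rfl⟩
  refine ⟨Matrix.specialUnitaryGroup (Fin 2) ℂ, inferInstance, inferInstance, inferInstance, inferInstance,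
    isCompactSimpleLieGroup_specialUnitaryGroup isSimpleCompactGroup_specialUnitaryGroup_holds le_rfl,
    simplyConnectedSpace_su2, fundRepSU2, unpinnedUnit, unpinnedUnit_pos, tendsto_unpinnedUnit, h, ?_⟩
  intro n ε _ hε0 hM
  refine ⟨floorBudget n, floorBudget_pos n, fun T β₂ => ?_⟩
  obtain ⟨β₃, hk⟩ := unpinnedUnit_kills n (eps_le_sixteenth hε0 hM) T
  exact ⟨max β₂ β₃, le_max_left _ _, fun b hb hlt => hk _ (le_max_right _ _) b hb hlt⟩

/-- **Bookkeeping (PROVED)**: `LowerBounds SU(2) fund unpinnedUnit → ¬ I♯_SC` — the ONLY thing separating the parasitic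
witness from a kill of the registered stub is the pinning hypothesis at its own unit (physics-grade false, see above). -/
theorem not_onsetSharpUKPcSC_of_lowerBounds_unpinnedUnit
    (h : letI : MeasurableSpace (Matrix.specialUnitaryGroup (Fin 2) ℂ) := borel _
      haveI : BorelSpace (Matrix.specialUnitaryGroup (Fin 2) ℂ) := ⟨rfl⟩
      LowerBounds (Matrix.specialUnitaryGroup (Fin 2) ℂ) fundRepSU2 unpinnedUnit) :
    ¬ OnsetSharpUKPcSC :=
  subscaleFailureSC_iff_not.1 (subscaleFailureSC_of_lowerBounds_unpinnedUnit h)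

end Summit.QuantumFields.YangMills.Cruxes.IR.AfPincerUc.SharpOnset

end
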